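import Summits.QuantumFields.BalabanUV.Beta.FP.RoadEndLeftUndressed
import Summits.QuantumFields.BalabanUV.Beta.FP.PerfectKernelSymmGeneric
import Summits.QuantumFields.BalabanUV.Beta.HessKerFourFamily

/-!
# `BalabanUV.Beta.FP.RoadLeftLiteralSwap` — road «FP» for binder row D1, THE LITERAL OF RECORD's FINITE-`j` LAW `hTj` (leaf-01, gen 13): THE WALL KERNELS OF
# `JsB12Sym` ARE TRANSPOSITION-SYMMETRIC AT EVERY `j` — `TbalOf Lc (JsB12Sym …) j a b t = TbalOf Lc (JsB12Sym …) j b a (−t)`, NO HYPOTHESIS — so the binder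
# `hTj` of the END of record (`RoadLeftAssemblyRows.d1Drift_left_of_sliceLedger_rows` ∕ `RoadLeftAssemblyLetters.…_rows_letters`) is a THEOREM for the literal

HONEST DEPENDENCY (page 1, mandatory): continuum YM on T⁴ ⇐ BetaPertH ∧ nine spine estimates (0/9 proved); BetaPertH ⇐ (D1) ∧ (D4) ∧
CAP+tail; G-an2-4 gates asym, D1 and NE2/3/4.  HONEST FRAMING (cell contract, verbatim): «discharging `BetaPertH` makes Bałaban's UV
stability UNCONDITIONAL — a real constructive-QFT result; it is NOT the continuum limit and NOT the Clay problem.»  THIS MODULE is [folklore] COMPOSITION BY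
NAME about an2's TYPED literal `SymmetrisedStepJets.JsB12Sym` (a NAME over a displayed table record `SymTables 3 Lc`, asserting nothing of Bałaban's):
the owner's `PerfectKernelSymmGeneric.TGenOf_swap` fed with (i) the decay and `Lc`-block covariance of the undressed step resolvent `KInvStep Lc j`
(Literature `decays_KInvStep`, `shiftK_KInvStep`), (ii) the localisation of the literal's stencils (the `JetData` fields), (iii) the translation rows (St)(Wt)
of the DRESSED literal (leaf-06's `RoadEndLeftUndressed.JsB12Sym_S_translate`∕`JsB12Sym_W_translate` ✓, over an2's `JsB12Sym0_S∕W_translate`), and (iv) the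
bond-swap symmetry of the literal's second-order tables — by CONSTRUCTION (`WrecOf = W2SymOfK …`, an2's `SpineRooted.WrecOf_swap` (module `RecursiveWSlot`)) and preserved by the
dressing (`dressSymAt_W` is `rfl`).  The comb-literal twin is `RoadRowD1Slots.TbalOf_JsRowD1_swap`.  No `def`, no `def … : Prop`, nothing cited, nothing of
the manuscripts under audit asserted, 0 sorry; 0 estimates; 0∕4 row-D1 binders; NOT `hWj` (the Ward row — an2 K-R5 lane), NOT (CONV-C), NOT SDF, NOT (ASYMP),
NOT D1, NOT BetaPertH, NOT continuum, NOT Clay.  «not in print; our bookkeeping».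

ABSOLUTE RULE (cell charter, verbatim): «No internally-minted statement may enter as a cited fact. Every hypothesis is either kernel-proved in this
package or a verbatim quotation of a PUBLISHED theorem with page reference. The manuscript(s) under audit are NOT citable for their own disputed
steps — they are the thing under adjudication; programme-internal (2001/route/tribunal) claims are never citable.»

CONTENT.  §1 [folklore] `JsB12Sym0_W_swap`, `JsB12Sym_W_swap` (bond-swap symmetry of the undressed ∕ dressed second-order tables, every `j`),
`locStencil_JsB12Sym_S` (the `JetData` letter, packaged).  §2 [folklore] **`TbalOf_JsB12Sym_swap`** and **`hTj_JsB12Sym`** — VERBATIM the binder `hTj` of the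
END of record at `Js := JsB12Sym hLc Ncol tabs cΛ cB`.
Provenance: D1 formalisation swarm LEAF PROVER 01, unit `b2b-balaban-beta-d1-formalise-leaf-01` gen 13, 2026-08-21 (INTENT 3, CLAIMS journal).
-/

noncomputable section

namespace Summit.QuantumFields.BalabanUV.Beta.FP.RoadLeftLiteralSwap

open Literature.MathematicalPhysics.QuantumFieldTheory
open Literature.MathematicalPhysics.QuantumFieldTheory.Balaban1983to89
open Literature.MathematicalPhysics.QuantumFieldTheory.Balaban1983to89.Beta
open ExpKernelCalculus (MKer Decays shiftK hessKer)
open OneStepResolventKernel (Fib LocStencil JetData)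
open OneStepKernelFamily (vertexOfK KInvStep TbalOf decays_KInvStep shiftK_KInvStep)
open Summit.QuantumFields.BalabanUV.Beta.SymmetrisedStepJets (SymTables JsB12Sym0 JsB12Sym JsB12Sym_apply JsB12Sym0_eq JsSym0Of_W WsymOf_eq)
open Summit.QuantumFields.BalabanUV.Beta.SymmetrisedDressingDress (dressSymAt_W)
open Summit.QuantumFields.BalabanUV.Beta.SpineRooted (WrecOf_swap)
open Summit.QuantumFields.BalabanUV.Beta.FP.RoadEndGeneric (TGenOf)
open Summit.QuantumFields.BalabanUV.Beta.FP.PerfectKernelSymmGeneric (TGenOf_swap)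
open Summit.QuantumFields.BalabanUV.Beta.FP.RoadEndLeftUndressed (JsB12Sym_S_translate JsB12Sym_W_translate)
open Summit.QuantumFields.BalabanUV.Beta.HessKerFourFamily (TbalOf_apply)

variable {Lc : ℕ} [NeZero Lc] (hLc : Odd Lc) (Ncol : ℕ) (tabs : SymTables 3 Lc) (cΛ cB : ℝ)

/-! ## §1 The literal's second-order tables are bond-swap symmetric; the stencils are local -/

/-- [folklore] **BOND-SWAP SYMMETRY OF THE UNDRESSED LITERAL's SECOND-ORDER TABLES**, every `j` — by construction: `(JsB12Sym⁰ j).W = WsymOf … j =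
W2SymOfK …` (`rfl`), and `W2SymOfK` is the bond-symmetrisation (an2's `SpineRooted.WrecOf_swap` (module `RecursiveWSlot`)). -/
theorem JsB12Sym0_W_swap (j : ℕ) (μ : Fin 4) (y : Fin 4 → ℤ) (ν : Fin 4) (y' : Fin 4 → ℤ) :
    (JsB12Sym0 hLc Ncol tabs cΛ cB j).W μ y ν y' = (JsB12Sym0 hLc Ncol tabs cΛ cB j).W ν y' μ y := by
  rw [JsB12Sym0_eq, JsSym0Of_W, WsymOf_eq]
  exact (WrecOf_swap _ _ _ _ _ _ _ _ j μ y ν y').symm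

/-- [folklore] **BOND-SWAP SYMMETRY OF THE DRESSED LITERAL's SECOND-ORDER TABLES**, every `j` (`dressSymAt_W` is `rfl`: the dressing acts on the kernel value only). -/
theorem JsB12Sym_W_swap (j : ℕ) (μ : Fin 4) (y : Fin 4 → ℤ) (ν : Fin 4) (y' : Fin 4 → ℤ) :
    (JsB12Sym hLc Ncol tabs cΛ cB j).W μ y ν y' = (JsB12Sym hLc Ncol tabs cΛ cB j).W ν y' μ y := by
  rw [JsB12Sym_apply, dressSymAt_W, dressSymAt_W, JsB12Sym0_W_swap]

/-- [folklore] The literal's stencils are a local stencil family at every `j` (the `JetData` letter, packaged existentially). -/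
theorem locStencil_JsB12Sym_S (j : ℕ) : ∃ Cs δs : ℝ, 0 < δs ∧ LocStencil (JsB12Sym hLc Ncol tabs cΛ cB j).S Cs δs :=
  ⟨_, _, (JsB12Sym hLc Ncol tabs cΛ cB j).δ_pos, (JsB12Sym hLc Ncol tabs cΛ cB j).loc⟩

/-! ## §2 `hTj` for the literal of record -/

/-- [folklore] **THE WALL KERNELS OF THE LITERAL OF RECORD ARE TRANSPOSITION-SYMMETRIC AT EVERY `j`**: `TbalOf Lc (JsB12Sym …) j a b t =
TbalOf Lc (JsB12Sym …) j b a (−t)` — `TbalOf_apply` (`rfl`: LEFT placement, undressed leg `KInvStep Lc j`, the dressing in the jets) + the owner's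
`TGenOf_swap` with `decays_KInvStep`, `shiftK_KInvStep`, the `JetData` localisation, leaf-06's (St)(Wt) rows of the dressed literal and §1's swap.  NO hypothesis. -/
theorem TbalOf_JsB12Sym_swap (j : ℕ) (a b : Fin (3 + 1)) (t : Fin (3 + 1) → ℤ) :
    TbalOf Lc (JsB12Sym hLc Ncol tabs cΛ cB) j a b t = TbalOf Lc (JsB12Sym hLc Ncol tabs cΛ cB) j b a (-t) := by
  obtain ⟨δ, C, hδ, hC, hK⟩ := decays_KInvStep (d := 3) (Lc := Lc) j
  obtain ⟨Cs, δs, hδs, hS⟩ := locStencil_JsB12Sym_S hLc Ncol tabs cΛ cB j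
  have key := TGenOf_swap (n := Lc) hK hδ (fun s => shiftK_KInvStep (d := 3) (Lc := Lc) j s) ⟨δ, C, hδ, hC, hK⟩
    (fun s => shiftK_KInvStep (d := 3) (Lc := Lc) j s) hS hδs
    (fun κ u s => JsB12Sym_S_translate hLc Ncol tabs cΛ cB j κ u s)
    (fun μ y ν y' s => JsB12Sym_W_translate hLc Ncol tabs cΛ cB j μ y ν y' s)
    (fun μ y ν y' => JsB12Sym_W_swap hLc Ncol tabs cΛ cB j μ y ν y') a b t
  rw [TbalOf_apply]
  exact key

/-- [folklore] **THE BINDER `hTj` OF THE END OF RECORD FOR THE LITERAL, LITERALLY** (`RoadLeftAssemblyRows.d1Drift_left_of_sliceLedger_rows`,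
`SymmetryInheritGeneric.swap_TGenOf_one_of_swapRow`): `∀ j a b t, TbalOf Lc (JsB12Sym …) j a b t = TbalOf Lc (JsB12Sym …) j b a (−t)`. -/
theorem hTj_JsB12Sym :
    ∀ (j : ℕ) (a b : Fin (3 + 1)) (t : Fin (3 + 1) → ℤ),
      TbalOf Lc (JsB12Sym hLc Ncol tabs cΛ cB) j a b t = TbalOf Lc (JsB12Sym hLc Ncol tabs cΛ cB) j b a (-t) :=
  fun j a b t => TbalOf_JsB12Sym_swap hLc Ncol tabs cΛ cB j a b t

end Summit.QuantumFields.BalabanUV.Beta.FP.RoadLeftLiteralSwap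

end
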